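import Summits.AtomisticToContinuum.HydrodynamicLimit.Theorems.LambertianContactSwapLambertianEulerMomentLedger
import Literature.MathematicalPhysics.KineticTheory.LambertianRedrawNondegenerate
import Literature.Analysis.FluidPDE.HardSphereFlowConstruction
import HarnessLib

/-!
# The expected-moment ledger along the Lambertian recursion

Helper file (`--supports`) of the crux `LambertianEuler` of route `LambertianContactSwap`
(`AtomisticToContinuum/HydrodynamicLimit`, stmt-AtomisticToContinuum-11854), line `Sketch`, stub
`stub_tailsLambda : LambertPairPovzner → TailsLambda` (card `cosine-povzner-ladder`, step T2),
continuing `LambertianContactSwapLambertianEulerMomentLedger`, whose `momentLedger_oneStep` is the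
ONE-STEP ledger: at a simple incoming collision the expected `2k`-th velocity moment
`M_{2k} = ∑ᵢ ‖vᵢ‖^{2k}` after the cosine redraw is at most `M_{2k}` plus the gain cap
`(4/(k+1)) (‖vᵢ‖² + ‖vⱼ‖²)^k` minus the loss `‖vᵢ‖^{2k} + ‖vⱼ‖^{2k}` of the colliding pair `(i, j)`.
Here that ledger is transported along the recursion `z_m = lambertStateAfter G ε ξs z m` driven
by `ξs ∼ lambertNoise = γ^ℕ`:

* `lintegral_lambertNoise_stateAfter_fresh` — the **fresh-noise lemma in expectation form** (any
  dimension, any regular measurable geometry): `E[F(z_m, ξs m)] = E[F̄(z_m)]` with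
  `F̄(w) = ∫ F(w, ξ) dγ(ξ)`, for measurable `F ≥ 0` (the `m`-th redraw is independent of the `m`-th
  state; restart identity `lambertStateAfter_succ_eq_tail` + Tonelli over `lambertNoise_map_headTail`,
  induction on `m` uniformly in the datum — the companion of the tree's almost-sure form
  `ae_lambertNoise_forall_stateAfter_notMem`);
* `integral_stateAfter_succ_le_of_step` — **transport**: a one-step conditional bound
  `E_ξ[M(lambertStep ξ w)] ≤ M(w) + I(w)` at the a.e.-visited states `w = z_m` gives
  `E[M(z_{m+1})] ≤ E[M(z_m) + I(z_m)]`, for any measurable `M ≥ 0`;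
* `integral_moment_lambertStep_le_increment` — the one-step ledger in guarded form (increment `0`
  if no collision is reached, gain cap minus loss of the unique incoming pair otherwise);
* `momentLedger_chain` (main theorem, term-style) — **the expected `2k`-th-moment ledger along
  the recursion**: if the `m`-th exit configuration is a.s. simple incoming when reached, then
  `E[M_{2k}(z_{m+1})] ≤ E[M_{2k}(z_m)] + E[increment_k(z_m)]` (pair Povzner bound `hPP` as
  hypothesis, as in the one-step file).

Not here (card T3–T5, open): gain domination by local empirical moments, the loss floor for fast
spheres, moment non-intermittency, Bobylev's induction in `k`, collision index versus time.
-/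

noncomputable section

open MeasureTheory ProbabilityTheory Set Function Filter
open scoped ENNReal InnerProductSpace BigOperators
namespace Summit.AtomisticToContinuum.HydrodynamicLimit.Theorems.LambertianContactSwapLambertianEulerMomentLedgerChain

open Literature.MathematicalPhysics.KineticTheory Literature.Analysis.FluidPDE
  Literature.Analysis.FluidPDE.Alexander
open Summit.AtomisticToContinuum.HydrodynamicLimit.Theorems.LambertianContactSwapLambertianEulerMomentLedger

/-! ## The fresh-noise lemma in expectation form, and transport of a one-step ledger -/

section FreshNoise

variable {d : Type*} [Fintype d]

/-- **Tonelli over the first redraw**: a `lintegral` against the Lambertian noise of a measurable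
function of (head, tail) is the iterated `lintegral` against `stdGaussian` and `lambertNoise`
(`lambertNoise_map_headTail`: `γ^ℕ ≅ γ ⊗ γ^ℕ`). [folklore] -/
theorem lintegral_lambertNoise_headTail
    {H : EuclideanSpace ℝ d × (ℕ → EuclideanSpace ℝ d) → ℝ≥0∞} (hH : Measurable H) :
    ∫⁻ ξs, H (ξs 0, fun m => ξs (m + 1)) ∂(lambertNoise d) =
      ∫⁻ ξ, ∫⁻ ξs, H (ξ, ξs) ∂(lambertNoise d) ∂(stdGaussian (EuclideanSpace ℝ d)) := by
  rw [← lintegral_prod _ hH.aemeasurable, ← lambertNoise_map_headTail d,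
    lintegral_map hH ((measurable_pi_apply 0).prodMk (measurable_tail d))]

variable {X : Type*} {N : ℕ} [TopologicalSpace X] [MeasurableSpace X] {G : Geometry d X} {ε : ℝ}

/-- **Fresh-noise lemma, expectation form**: for a fixed datum `z`, a measurable
`F : (state, noise) → [0, ∞]` and every `m`, `E[F(z_m, ξs m)] = E[F̄(z_m)]` with
`F̄(w) = ∫ F(w, ξ) dγ(ξ)` — the `m`-th noise is independent of the `m`-th state
`z_m = lambertStateAfter G ε ξs z m` (a function of `ξs 0, …, ξs (m-1)`), so conditional
expectations given the past are Gaussian averages over the fresh redraw. Induction on `m`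
uniformly in `z` through the restart identity `lambertStateAfter_succ_eq_tail` and Tonelli over
`lambertNoise ≅ stdGaussian ⊗ lambertNoise` (regular measurable geometry, for the measurability
of the states). [folklore] -/
theorem lintegral_lambertNoise_stateAfter_fresh (hG : G.IsHardSphereRegular ε)
    (hGm : G.IsMeasurable) {F : Config N d X × EuclideanSpace ℝ d → ℝ≥0∞} (hF : Measurable F)
    (m : ℕ) (z : Config N d X) :
    ∫⁻ ξs, F (lambertStateAfter G ε ξs z m, ξs m) ∂(lambertNoise d) =
      ∫⁻ ξs, (∫⁻ ξ, F (lambertStateAfter G ε ξs z m, ξ) ∂(stdGaussian (EuclideanSpace ℝ d)))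
        ∂(lambertNoise d) := by
  induction m generalizing z with
  | zero =>
    simp only [lambertStateAfter_zero, lintegral_const, measure_univ, mul_one]
    have hmap : (lambertNoise d).map (fun ξs : ℕ → EuclideanSpace ℝ d => ξs 0) =
        stdGaussian (EuclideanSpace ℝ d) :=
      Measure.infinitePi_map_eval (fun _ : ℕ => stdGaussian (EuclideanSpace ℝ d)) 0
    have hFz : Measurable fun ξ : EuclideanSpace ℝ d => F (z, ξ) :=
      hF.comp (measurable_const.prodMk measurable_id)
    rw [← hmap, lintegral_map hFz (measurable_pi_apply 0)]
  | succ m ih =>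
    have hΨ : Measurable fun q : EuclideanSpace ℝ d × (ℕ → EuclideanSpace ℝ d) =>
        lambertStateAfter G ε q.2 (lambertStep G ε q.1 z) m :=
      measurable_lambertStateAfter_comp hG hGm
        (measurable_lambertStep_comp hG hGm measurable_const measurable_fst) measurable_snd m
    have h1 : Measurable fun q : EuclideanSpace ℝ d × (ℕ → EuclideanSpace ℝ d) =>
        F (lambertStateAfter G ε q.2 (lambertStep G ε q.1 z) m, q.2 m) :=
      hF.comp (hΨ.prodMk ((measurable_pi_apply m).comp measurable_snd))
    have h2 : Measurable fun q : EuclideanSpace ℝ d × (ℕ → EuclideanSpace ℝ d) =>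
        ∫⁻ ξ, F (lambertStateAfter G ε q.2 (lambertStep G ε q.1 z) m, ξ)
          ∂(stdGaussian (EuclideanSpace ℝ d)) :=
      hF.lintegral_prod_right'.comp hΨ
    simp only [lambertStateAfter_succ_eq_tail]
    calc ∫⁻ ξs, F (lambertStateAfter G ε (fun n => ξs (n + 1)) (lambertStep G ε (ξs 0) z) m,
          ξs (m + 1)) ∂(lambertNoise d)
        = ∫⁻ ξ, ∫⁻ ξs, F (lambertStateAfter G ε ξs (lambertStep G ε ξ z) m, ξs m)
            ∂(lambertNoise d) ∂(stdGaussian (EuclideanSpace ℝ d)) :=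
          lintegral_lambertNoise_headTail h1
      _ = ∫⁻ ξ, ∫⁻ ξs, (∫⁻ η, F (lambertStateAfter G ε ξs (lambertStep G ε ξ z) m, η)
            ∂(stdGaussian (EuclideanSpace ℝ d))) ∂(lambertNoise d)
            ∂(stdGaussian (EuclideanSpace ℝ d)) :=
          lintegral_congr fun ξ => ih (lambertStep G ε ξ z)
      _ = ∫⁻ ξs, (∫⁻ η, F (lambertStateAfter G ε (fun n => ξs (n + 1)) (lambertStep G ε (ξs 0) z) m,
            η) ∂(stdGaussian (EuclideanSpace ℝ d))) ∂(lambertNoise d) :=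
          (lintegral_lambertNoise_headTail h2).symm

/-- **A one-step conditional ledger propagates along the Lambertian recursion.** Let `M ≥ 0` be a
measurable functional of the state and `I` another functional. If, for `lambertNoise`-a.e. noise
sequence, at the `m`-th state `w = z_m` the Gaussian average of `M` after one more step exists and
is at most `M(w) + I(w)`, then `E[M(z_{m+1})] ≤ E[M(z_m) + I(z_m)]` — the `m`-th redraw is fresh
(`lintegral_lambertNoise_stateAfter_fresh`). [folklore] -/
theorem integral_stateAfter_succ_le_of_step (hG : G.IsHardSphereRegular ε) (hGm : G.IsMeasurable)
    {M I : Config N d X → ℝ} (hMm : Measurable M) (hM0 : ∀ w, 0 ≤ M w) (m : ℕ) (z : Config N d X)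
    (hint : Integrable (fun ξs => M (lambertStateAfter G ε ξs z m) +
      I (lambertStateAfter G ε ξs z m)) (lambertNoise d))
    (hA : ∀ᵐ ξs ∂(lambertNoise d),
      Integrable (fun ξ => M (lambertStep G ε ξ (lambertStateAfter G ε ξs z m)))
          (stdGaussian (EuclideanSpace ℝ d)) ∧
        ∫ ξ, M (lambertStep G ε ξ (lambertStateAfter G ε ξs z m))
            ∂(stdGaussian (EuclideanSpace ℝ d)) ≤
          M (lambertStateAfter G ε ξs z m) + I (lambertStateAfter G ε ξs z m)) :
    ∫ ξs, M (lambertStateAfter G ε ξs z (m + 1)) ∂(lambertNoise d) ≤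
      ∫ ξs, (M (lambertStateAfter G ε ξs z m) + I (lambertStateAfter G ε ξs z m))
        ∂(lambertNoise d) := by
  have hF : Measurable fun q : Config N d X × EuclideanSpace ℝ d =>
      ENNReal.ofReal (M (lambertStep G ε q.2 q.1)) :=
    (hMm.comp (measurable_lambertStep hG hGm)).ennreal_ofReal
  have hZ1 : AEStronglyMeasurable (fun ξs => M (lambertStateAfter G ε ξs z (m + 1)))
      (lambertNoise d) :=
    (hMm.comp (measurable_lambertStateAfter_comp hG hGm measurable_const measurable_id
      (m + 1))).aestronglyMeasurable
  have hG0 : 0 ≤ᵐ[lambertNoise d] fun ξs =>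
      M (lambertStateAfter G ε ξs z m) + I (lambertStateAfter G ε ξs z m) := by
    filter_upwards [hA] with ξs hξs
    exact (integral_nonneg fun ξ => hM0 _).trans hξs.2
  have hbound : ∫⁻ ξs, ENNReal.ofReal (M (lambertStateAfter G ε ξs z (m + 1))) ∂(lambertNoise d) ≤
      ∫⁻ ξs, ENNReal.ofReal (M (lambertStateAfter G ε ξs z m) + I (lambertStateAfter G ε ξs z m))
        ∂(lambertNoise d) := by
    calc ∫⁻ ξs, ENNReal.ofReal (M (lambertStateAfter G ε ξs z (m + 1))) ∂(lambertNoise d)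
        = ∫⁻ ξs, ENNReal.ofReal (M (lambertStep G ε (ξs m) (lambertStateAfter G ε ξs z m)))
            ∂(lambertNoise d) := by
          simp only [lambertStateAfter_succ]
      _ = ∫⁻ ξs, ∫⁻ ξ, ENNReal.ofReal (M (lambertStep G ε ξ (lambertStateAfter G ε ξs z m)))
            ∂(stdGaussian (EuclideanSpace ℝ d)) ∂(lambertNoise d) :=
          lintegral_lambertNoise_stateAfter_fresh hG hGm hF m z
      _ ≤ _ := lintegral_mono_ae ?_
    filter_upwards [hA] with ξs hξs
    rw [← ofReal_integral_eq_lintegral_ofReal hξs.1 (Eventually.of_forall fun ξ => hM0 _)]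
    exact ENNReal.ofReal_le_ofReal hξs.2
  rw [integral_eq_lintegral_of_nonneg_ae (Eventually.of_forall fun ξs => hM0 _) hZ1,
    ← ENNReal.toReal_ofReal (integral_nonneg_of_ae hG0)]
  exact ENNReal.toReal_mono ENNReal.ofReal_ne_top
    (hbound.trans_eq (ofReal_integral_eq_lintegral_ofReal hint hG0).symm)

end FreshNoise

/-! ## The one-step ledger in guarded form, with measurability and energy bounds -/

section OneStep

variable {N : ℕ}

/-- For a fixed state, the Lambertian step is measurable in the noise alone (any geometry).
[folklore] -/
theorem measurable_lambertStep_noise (G : Geometry (Fin 3) T3) (ε : ℝ) (w : Config N (Fin 3) T3) :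
    Measurable fun ξ : V3 => lambertStep G ε ξ w := by
  simp only [lambertStep_eq]
  split_ifs
  · exact measurable_const
  · unfold lambertStepMap
    split_ifs
    · exact measurable_lambertPair_noise G _ _ _
    · exact measurable_const

/-- The kinetic energy is nonnegative. [folklore] -/
theorem configEnergy_nonneg (w : Config N (Fin 3) T3) : 0 ≤ configEnergy w := by
  unfold configEnergy; positivity

/-- Each squared speed is at most twice the kinetic energy. [folklore] -/
theorem sq_norm_vel_le_two_mul_configEnergy (w : Config N (Fin 3) T3) (i : Fin N) :
    ‖(w i).2‖ ^ 2 ≤ 2 * configEnergy w := by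
  rw [configEnergy, ← mul_assoc, mul_inv_cancel₀ two_ne_zero, one_mul]
  exact Finset.single_le_sum (f := fun l => ‖(w l).2‖ ^ 2) (fun l _ => sq_nonneg _)
    (Finset.mem_univ i)

/-- The `2k`-th velocity moment is controlled by the kinetic energy: `∑ᵢ ‖vᵢ‖^{2k} ≤ N (2E)^k`.
[folklore] -/
theorem moment_le_card_mul_pow (w : Config N (Fin 3) T3) (k : ℕ) :
    ∑ i, ‖(w i).2‖ ^ (2 * k) ≤ N * (2 * configEnergy w) ^ k := by
  have h : ∀ i ∈ Finset.univ, ‖(w i).2‖ ^ (2 * k) ≤ (2 * configEnergy w) ^ k := fun i _ => by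
    rw [pow_mul]
    exact pow_le_pow_left₀ (sq_nonneg _) (sq_norm_vel_le_two_mul_configEnergy w i) k
  exact (Finset.sum_le_sum h).trans (by simp)

/-- The `2k`-th velocity moment is a measurable function of the configuration. [folklore] -/
theorem measurable_moment (k : ℕ) :
    Measurable fun w : Config N (Fin 3) T3 => ∑ i, ‖(w i).2‖ ^ (2 * k) :=
  Finset.measurable_sum _ fun i _ => ((measurable_pi_apply i).snd.norm.pow_const _)

/-- For every state, the `2k`-th moment after one Lambertian step is an integrable function of
the noise (measurable, and bounded through the nonincreasing kinetic energy). [folklore] -/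
theorem integrable_moment_lambertStep (G : Geometry (Fin 3) T3) (ε : ℝ) (k : ℕ)
    (w : Config N (Fin 3) T3) :
    Integrable (fun ξ : V3 => ∑ i, ‖(lambertStep G ε ξ w i).2‖ ^ (2 * k)) (stdGaussian V3) := by
  refine Integrable.of_bound ((measurable_moment k).comp (measurable_lambertStep_noise G ε w)
    |>.aestronglyMeasurable) (N * (2 * configEnergy w) ^ k) (Eventually.of_forall fun ξ => ?_)
  rw [Real.norm_of_nonneg (by positivity)]
  have h0 := configEnergy_nonneg (lambertStep G ε ξ w)
  exact (moment_le_card_mul_pow _ k).trans (mul_le_mul_of_nonneg_left (pow_le_pow_left₀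
    (by positivity) (mul_le_mul_of_nonneg_left (configEnergy_lambertStep_le ξ w) zero_le_two) k)
    (Nat.cast_nonneg _))

/-- **One-step ledger, guarded form** (pointwise in the state, any geometry). For a state `w`
whose exit configuration, if reached (`τ(w) < ∞`), has exactly one incoming contact pair, the
expected `2k`-th moment after one Lambertian step is at most `M_{2k}(w)` plus the **ledger
increment** `1_{τ(w) < ∞} ∑_p 1_{incomingPairs = {p}} [(4/(k+1)) (‖v_{p₁}‖² + ‖v_{p₂}‖²)^k −
‖v_{p₁}‖^{2k} − ‖v_{p₂}‖^{2k}]` (gain cap minus loss of the colliding pair; `0` if no collision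
is reached, the step being then the identity). [folklore] -/
theorem integral_moment_lambertStep_le_increment
    (hPP : ∀ (N : ℕ) (G : Geometry (Fin 3) T3) (i j : Fin N), i ≠ j →
      ∀ z : Config N (Fin 3) T3, G.sepVec (z i).1 (z j).1 ≠ 0 → ∀ k : ℕ,
        ∫ ξ, (‖(lambertPair G i j z ξ i).2‖ ^ (2 * k) + ‖(lambertPair G i j z ξ j).2‖ ^ (2 * k))
            ∂(stdGaussian V3) ≤ 4 / (k + 1) * (‖(z i).2‖ ^ 2 + ‖(z j).2‖ ^ 2) ^ k)
    (G : Geometry (Fin 3) T3) {ε : ℝ} (hε : ε ≠ 0) (k : ℕ) {w : Config N (Fin 3) T3}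
    (hw : freeExitTime G ε w ≠ ⊤ →
      ∃ p : Fin N × Fin N, incomingPairs G ε (freeFlight G (freeExitTime G ε w).toReal w) = {p}) :
    ∫ ξ, (∑ i, ‖(lambertStep G ε ξ w i).2‖ ^ (2 * k)) ∂(stdGaussian V3) ≤
      (∑ i, ‖(w i).2‖ ^ (2 * k)) +
        (if freeExitTime G ε w = ⊤ then (0 : ℝ) else ∑ p : Fin N × Fin N,
          if incomingPairs G ε (freeFlight G (freeExitTime G ε w).toReal w) = {p} then
            4 / (k + 1) * (‖(w p.1).2‖ ^ 2 + ‖(w p.2).2‖ ^ 2) ^ k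
              - ‖(w p.1).2‖ ^ (2 * k) - ‖(w p.2).2‖ ^ (2 * k)
          else 0) := by
  by_cases hτ : freeExitTime G ε w = ⊤
  · simp only [hτ, if_true, add_zero, lambertStep_of_eq_top hτ, integral_const, smul_eq_mul,
      probReal_univ, one_mul, le_refl]
  · obtain ⟨p, hp⟩ := hw hτ
    rw [if_neg hτ, hp]
    simp only [Set.singleton_eq_singleton_iff, Finset.sum_ite_eq, Finset.mem_univ, if_true]
    exact momentLedger_oneStep hPP G hε k hτ hp

variable {G : Geometry (Fin 3) T3} {ε : ℝ}

/-- The event "the exit configuration of `w` has incoming pairs exactly `{p}`" is measurable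
(regular measurable geometry). [folklore] -/
theorem measurableSet_incomingPairs_exit_eq_singleton (hG : G.IsHardSphereRegular ε)
    (hGm : G.IsMeasurable) (p : Fin N × Fin N) :
    MeasurableSet {w : Config N (Fin 3) T3 |
      incomingPairs G ε (freeFlight G (freeExitTime G ε w).toReal w) = {p}} := by
  have hexit : Measurable fun w : Config N (Fin 3) T3 =>
      freeFlight G (freeExitTime G ε w).toReal w :=
    hGm.measurable_freeFlight₂.comp ((measurable_freeExitTime hG hGm).ennreal_toReal.prodMk
      measurable_id)
  have hset : {w : Config N (Fin 3) T3 |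
      incomingPairs G ε (freeFlight G (freeExitTime G ε w).toReal w) = {p}} =
      ⋂ q : Fin N × Fin N, {w | q ∈ incomingPairs G ε (freeFlight G (freeExitTime G ε w).toReal w)
        ↔ q = p} := by
    ext w
    simp only [Set.mem_setOf_eq, Set.mem_iInter, Set.ext_iff, Set.mem_singleton_iff]
  rw [hset]
  refine MeasurableSet.iInter fun q => measurableSet_setOf.2 ?_
  exact (measurableSet_setOf.1 ((measurableSet_mem_incomingPairs hGm q).preimage hexit)).iff
    measurable_const

/-- The ledger increment is a measurable function of the state (regular measurable geometry).
[folklore] -/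
theorem measurable_increment (hG : G.IsHardSphereRegular ε) (hGm : G.IsMeasurable) (k : ℕ) :
    Measurable fun w : Config N (Fin 3) T3 =>
      (if freeExitTime G ε w = ⊤ then (0 : ℝ) else ∑ p : Fin N × Fin N,
        if incomingPairs G ε (freeFlight G (freeExitTime G ε w).toReal w) = {p} then
          4 / (k + 1) * (‖(w p.1).2‖ ^ 2 + ‖(w p.2).2‖ ^ 2) ^ k
            - ‖(w p.1).2‖ ^ (2 * k) - ‖(w p.2).2‖ ^ (2 * k)
        else 0) := by
  refine Measurable.ite ((measurable_freeExitTime hG hGm) (measurableSet_singleton _))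
    measurable_const (Finset.measurable_sum _ fun p _ => ?_)
  refine Measurable.ite (measurableSet_incomingPairs_exit_eq_singleton hG hGm p) ?_
    measurable_const
  have h1 : Measurable fun w : Config N (Fin 3) T3 => ‖(w p.1).2‖ :=
    (measurable_pi_apply p.1).snd.norm
  have h2 : Measurable fun w : Config N (Fin 3) T3 => ‖(w p.2).2‖ :=
    (measurable_pi_apply p.2).snd.norm
  exact ((measurable_const.mul (((h1.pow_const 2).add (h2.pow_const 2)).pow_const k)).sub
    (h1.pow_const _)).sub (h2.pow_const _)

/-- The ledger increment is bounded through the kinetic energy: if `2E(w) ≤ B` then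
`|increment| ≤ |Fin N × Fin N| · ((4/(k+1)) (2B)^k + 2 B^k)`. [folklore] -/
theorem abs_increment_le {k : ℕ} {B : ℝ} {w : Config N (Fin 3) T3} (hB : 2 * configEnergy w ≤ B) :
    |(if freeExitTime G ε w = ⊤ then (0 : ℝ) else ∑ p : Fin N × Fin N,
        if incomingPairs G ε (freeFlight G (freeExitTime G ε w).toReal w) = {p} then
          4 / (k + 1) * (‖(w p.1).2‖ ^ 2 + ‖(w p.2).2‖ ^ 2) ^ k
            - ‖(w p.1).2‖ ^ (2 * k) - ‖(w p.2).2‖ ^ (2 * k)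
        else 0)| ≤
      Fintype.card (Fin N × Fin N) * (4 / (k + 1) * (B + B) ^ k + B ^ k + B ^ k) := by
  have hv : ∀ i, ‖(w i).2‖ ^ 2 ≤ B := fun i => (sq_norm_vel_le_two_mul_configEnergy w i).trans hB
  have hB0 : 0 ≤ B := by linarith [configEnergy_nonneg w]
  have hC0 : 0 ≤ 4 / (k + 1) * (B + B) ^ k + B ^ k + B ^ k := by positivity
  have hterm : ∀ p : Fin N × Fin N, |4 / (k + 1) * (‖(w p.1).2‖ ^ 2 + ‖(w p.2).2‖ ^ 2) ^ k
      - ‖(w p.1).2‖ ^ (2 * k) - ‖(w p.2).2‖ ^ (2 * k)| ≤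
        4 / (k + 1) * (B + B) ^ k + B ^ k + B ^ k := by
    intro p
    have h1 : 4 / (k + 1) * (‖(w p.1).2‖ ^ 2 + ‖(w p.2).2‖ ^ 2) ^ k ≤ 4 / (k + 1) * (B + B) ^ k :=
      mul_le_mul_of_nonneg_left (pow_le_pow_left₀ (by positivity) (add_le_add (hv p.1) (hv p.2)) k)
        (by positivity)
    have h2 : ‖(w p.1).2‖ ^ (2 * k) ≤ B ^ k := by
      rw [pow_mul]; exact pow_le_pow_left₀ (sq_nonneg _) (hv p.1) k
    have h3 : ‖(w p.2).2‖ ^ (2 * k) ≤ B ^ k := by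
      rw [pow_mul]; exact pow_le_pow_left₀ (sq_nonneg _) (hv p.2) k
    have h4 : 0 ≤ 4 / (k + 1) * (‖(w p.1).2‖ ^ 2 + ‖(w p.2).2‖ ^ 2) ^ k := by positivity
    have h5 : 0 ≤ ‖(w p.1).2‖ ^ (2 * k) := by positivity
    have h6 : 0 ≤ ‖(w p.2).2‖ ^ (2 * k) := by positivity
    rw [abs_le]
    constructor <;> linarith
  split_ifs with hτ
  · rw [abs_zero]; positivity
  · refine (Finset.abs_sum_le_sum_abs _ _).trans ((Finset.sum_le_card_nsmul _ _ _
      fun p _ => ?_).trans (by rw [Finset.card_univ, nsmul_eq_mul]))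
    split_ifs
    · exact hterm p
    · rw [abs_zero]; exact hC0

end OneStep

/-! ## The expected-moment ledger along the Lambertian recursion -/

section Ledger

/-- **The expected `2k`-th-moment ledger along the Lambertian recursion** (card
`cosine-povzner-ladder`, T2). Let `hPP` be the pair Povzner bound of the cosine redraw, `G` a
regular measurable geometry on `𝕋³` at diameter `ε ≠ 0` (e.g. `Torus.geometry (Fin 3)` with
`ε < 1/2`), and `z` a datum whose `m`-th exit configuration along the recursion driven by
`ξs ∼ lambertNoise` is, almost surely, simple incoming whenever it is reached. Then
`E[M_{2k}(z_{m+1})] ≤ E[M_{2k}(z_m)] + E[1_{τ(z_m)<∞} ((4/(k+1)) (‖vᵢ‖² + ‖vⱼ‖²)^k − ‖vᵢ‖^{2k} −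
‖vⱼ‖^{2k})(z_m)]`, `(i, j)` the colliding pair of `z_m`: in the mean, the `2k`-th moment changes
at the `m`-th collision by at most the gain cap minus the loss of the colliding pair (all three
integrands are bounded through the kinetic energy; term-style statement). [folklore] -/
theorem momentLedger_chain :
    ∀ (hPP : ∀ (N : ℕ) (G : Geometry (Fin 3) T3) (i j : Fin N), i ≠ j →
      ∀ z : Config N (Fin 3) T3, G.sepVec (z i).1 (z j).1 ≠ 0 → ∀ k : ℕ,
        ∫ ξ, (‖(lambertPair G i j z ξ i).2‖ ^ (2 * k) + ‖(lambertPair G i j z ξ j).2‖ ^ (2 * k))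
            ∂(stdGaussian V3) ≤ 4 / (k + 1) * (‖(z i).2‖ ^ 2 + ‖(z j).2‖ ^ 2) ^ k)
    {N : ℕ} {G : Geometry (Fin 3) T3} {ε : ℝ}
    (hG : G.IsHardSphereRegular ε) (hGm : G.IsMeasurable) (hε : ε ≠ 0) (k m : ℕ)
    (z : Config N (Fin 3) T3)
    (hsimple : ∀ᵐ ξs ∂(lambertNoise (Fin 3)),
      freeExitTime G ε (lambertStateAfter G ε ξs z m) ≠ ⊤ →
        ∃ p : Fin N × Fin N, incomingPairs G ε (freeFlight G
          (freeExitTime G ε (lambertStateAfter G ε ξs z m)).toReal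
            (lambertStateAfter G ε ξs z m)) = {p}),
    ∫ ξs, (∑ i, ‖(lambertStateAfter G ε ξs z (m + 1) i).2‖ ^ (2 * k)) ∂(lambertNoise (Fin 3)) ≤
      ∫ ξs, (∑ i, ‖(lambertStateAfter G ε ξs z m i).2‖ ^ (2 * k)) ∂(lambertNoise (Fin 3)) +
      ∫ ξs, (if freeExitTime G ε (lambertStateAfter G ε ξs z m) = ⊤ then (0 : ℝ) else
          ∑ p : Fin N × Fin N,
            if incomingPairs G ε (freeFlight G
                (freeExitTime G ε (lambertStateAfter G ε ξs z m)).toReal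
                  (lambertStateAfter G ε ξs z m)) = {p} then
              4 / (k + 1) * (‖(lambertStateAfter G ε ξs z m p.1).2‖ ^ 2 +
                  ‖(lambertStateAfter G ε ξs z m p.2).2‖ ^ 2) ^ k
                - ‖(lambertStateAfter G ε ξs z m p.1).2‖ ^ (2 * k)
                - ‖(lambertStateAfter G ε ξs z m p.2).2‖ ^ (2 * k)
            else 0) ∂(lambertNoise (Fin 3)) := by
  intro hPP N G ε hG hGm hε k m z hsimple
  have hZ : Measurable fun ξs : ℕ → V3 => lambertStateAfter G ε ξs z m :=
    measurable_lambertStateAfter_comp hG hGm measurable_const measurable_id m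
  have hEB : ∀ ξs : ℕ → V3, 2 * configEnergy (lambertStateAfter G ε ξs z m) ≤ 2 * configEnergy z :=
    fun ξs => mul_le_mul_of_nonneg_left (configEnergy_lambertStateAfter_le ξs z m) zero_le_two
  have hintM : Integrable (fun ξs : ℕ → V3 => ∑ i, ‖(lambertStateAfter G ε ξs z m i).2‖ ^ (2 * k))
      (lambertNoise (Fin 3)) := by
    refine Integrable.of_bound ((measurable_moment k).comp hZ).aestronglyMeasurable
      (N * (2 * configEnergy z) ^ k) (Eventually.of_forall fun ξs => ?_)
    rw [Real.norm_of_nonneg (by positivity)]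
    have h0 := configEnergy_nonneg (lambertStateAfter G ε ξs z m)
    exact (moment_le_card_mul_pow _ k).trans (mul_le_mul_of_nonneg_left
      (pow_le_pow_left₀ (by positivity) (hEB ξs) k) (Nat.cast_nonneg _))
  have hintI := Integrable.of_bound ((measurable_increment hG hGm k).comp hZ).aestronglyMeasurable
    (μ := lambertNoise (Fin 3)) _ (Eventually.of_forall fun ξs => abs_increment_le (hEB ξs))
  refine (integral_stateAfter_succ_le_of_step hG hGm (measurable_moment k)
    (I := fun w => if freeExitTime G ε w = ⊤ then (0 : ℝ) else ∑ p : Fin N × Fin N,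
      if incomingPairs G ε (freeFlight G (freeExitTime G ε w).toReal w) = {p} then
        4 / (k + 1) * (‖(w p.1).2‖ ^ 2 + ‖(w p.2).2‖ ^ 2) ^ k
          - ‖(w p.1).2‖ ^ (2 * k) - ‖(w p.2).2‖ ^ (2 * k)
      else 0)
    (fun w => by positivity) m z (hintM.add hintI) ?_).trans_eq (integral_add hintM hintI)
  filter_upwards [hsimple] with ξs hξs
  exact ⟨integrable_moment_lambertStep G ε k _, integral_moment_lambertStep_le_increment hPP G hε k hξs⟩

end Ledger
end Summit.AtomisticToContinuum.HydrodynamicLimit.Theorems.LambertianContactSwapLambertianEulerMomentLedgerChain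

end
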